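import Mathlib
import Summits.Ventures.HodgeRepro.Tier4.Line4.AwayDomainRow
import Summits.Ventures.HodgeRepro.Tier4.Line4.TorusFinAtCompact

/-!
# Tier4/Line4/AwayDomainRowNonsplit — the product domain of record at the SEESAW PLANE with BOTH (E1) clauses by name:
`hdisc` (L1-p2's CentreAwayFiniteRow) and `hTS` (L2-p1's TorusFinAtCompact) — the displayed input of (E1) is `hns` alone

Blind re-derivation cell `pub-hodge-repro`, Tier 4 «prove the step» (README §9–§10), seat t4-L2-p2 (gen 6; L2-p1 g4's
S16117 / S16121: «your AwayDomainRow then carries NO `hTS` binder»).  Tree path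
`lean/Summits/Ventures/HodgeRepro/Tier4/Line4/AwayDomainRowNonsplit.lean`.  Imports this seat's `Line4/AwayDomainRow`
(`exists_isFundamentalDomain_prod_univ_withTransportedTorus`, p715192) and L2-p1's `Line4/TorusFinAtCompact`
(`compactSpace_torusFinAt_withTransportedTorus_of_nonsplit`, p715314).  Mathlib-level; no literature; no `def`.

**`exists_isFundamentalDomain_prod_univ_withTransportedTorus_of_nonsplit`**: AwayDomainRow's theorem with the binder
`hTS : CompactSpace (torusFinAt W′ (placesAbove p))` REMOVED — it is `compactSpace_torusFinAt_withTransportedTorus_of_nonsplit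
q a b g g' hgg' hg'g hgΩ ha hb ht hn p hp.ne_zero hns`.  Every other binder and the conclusion are token-identical to
AwayDomainRow's: on the plane of record, for a prime `p` with the (E1) local clause `hns` (every place above `p` non-split
in `k(√(t² − 4n))`), under `ht : q.t = 0`, `hn`, the CM clauses `hreal`/`hcm` and ZDOMAIN-EX's cocompactness `hZc`, there is
a measurable fundamental domain `DA` for `centreAway` in `T_f^{(p)}` with `DZ_f := torusFinSplit⁻¹(univ ×ˢ DA)` a measurable
fundamental domain for `Z(k)` in `T_f` satisfying ZDOMAIN-EX (iv) — the `DA hDA hfd hDZc` binders of the (7b) layers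
(TailSeesawFinNV / Count / Chain) and of x2's MainTermSplit at `DZS := univ`.

Nothing here says anything about the status of the Hodge conjecture for CM abelian varieties, which is NOT proved
(HC_CM is NOT proved by anyone in this repository).
-/

set_option autoImplicit false

noncomputable section

namespace Summit.Ventures.HodgeRepro.Tier4.Line4

open Summit.Ventures.HodgeRepro.Tier4 Summit.Ventures.HodgeRepro.Tier4.Common
  Summit.Ventures.HodgeRepro.Tier4.Line1 NumberField IsDedekindDomain MeasureTheory
open scoped NumberField NNReal ENNReal Pointwise

section Row

variable {k : Type} [Field k] [NumberField k] (q : QuadData k) (a b : k) (g g' : Matrix (Fin 4) (Fin 4) k)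
  (hgg' : g * g' = 1) (hg'g : g' * g = 1) (hgΩ : g * (PlaneData.mixedRow q a b).Ω = (PlaneData.mixedRow q a b).Ω * g)

/-- **The product domain of record at the seesaw plane, `hdisc` AND `hTS` by name: (E1)'s displayed input is `hns` alone.** -/
theorem exists_isFundamentalDomain_prod_univ_withTransportedTorus_of_nonsplit (ha : a ≠ 0) (hb : b ≠ 0) (ht : q.t = 0)
    (hn : ¬ IsSquare (-q.n)) (hreal : ∀ w : InfinitePlace k, w.IsReal) (hcm : ∀ w, IsCMAt q w) {p : ℕ} (hp : p.Prime)
    (hns : ∀ v ∈ placesAbove (k := k) p, ¬ IsSquare (algebraMap k (v.adicCompletion k) (q.t ^ 2 - 4 * q.n)))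
    [MeasurableSpace (torusT ((PlaneData.mixedRow q a b).withTransportedTorus g g' hgg' hg'g hgΩ))]
    [BorelSpace (torusT ((PlaneData.mixedRow q a b).withTransportedTorus g g' hgg' hg'g hgΩ))]
    (νf : Measure (torusFin ((PlaneData.mixedRow q a b).withTransportedTorus g g' hgg' hg'g hgΩ))) [νf.IsHaarMeasure]
    (νS : Measure (torusFinAt ((PlaneData.mixedRow q a b).withTransportedTorus g g' hgg' hg'g hgΩ) (placesAbove (k := k) p)))
    [νS.IsHaarMeasure]
    (νA : Measure (torusFinAway ((PlaneData.mixedRow q a b).withTransportedTorus g g' hgg' hg'g hgΩ) (placesAbove (k := k) p)))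
    [νA.IsHaarMeasure] (c : ℝ≥0)
    (hc : νf = c • Measure.map (torusFinSplit ((PlaneData.mixedRow q a b).withTransportedTorus g g' hgg' hg'g hgΩ)
      (placesAbove (k := k) p)).symm (νS.prod νA))
    (hZc : ∃ E : Set (torusFin ((PlaneData.mixedRow q a b).withTransportedTorus g g' hgg' hg'g hgΩ)), IsCompact E ∧
      E ⊆ (ZfIn ((PlaneData.mixedRow q a b).withTransportedTorus g g' hgg' hg'g hgΩ) : Set _) ∧
      (ZfIn ((PlaneData.mixedRow q a b).withTransportedTorus g g' hgg' hg'g hgΩ) : Set _) ⊆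
        (centreFin ((PlaneData.mixedRow q a b).withTransportedTorus g g' hgg' hg'g hgΩ) : Set _) * E) :
    ∃ DA : Set (torusFinAway ((PlaneData.mixedRow q a b).withTransportedTorus g g' hgg' hg'g hgΩ) (placesAbove (k := k) p)),
      MeasurableSet DA ∧
      IsFundamentalDomain (centreAway ((PlaneData.mixedRow q a b).withTransportedTorus g g' hgg' hg'g hgΩ)
        (placesAbove (k := k) p)) DA νA ∧
      MeasurableSet ((torusFinSplit ((PlaneData.mixedRow q a b).withTransportedTorus g g' hgg' hg'g hgΩ)
        (placesAbove (k := k) p)) ⁻¹' (Set.univ ×ˢ DA)) ∧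
      IsFundamentalDomain (centreFin ((PlaneData.mixedRow q a b).withTransportedTorus g g' hgg' hg'g hgΩ))
        ((torusFinSplit ((PlaneData.mixedRow q a b).withTransportedTorus g g' hgg' hg'g hgΩ) (placesAbove (k := k) p)) ⁻¹'
          (Set.univ ×ˢ DA)) νf ∧
      ∀ C : Set (torusFin ((PlaneData.mixedRow q a b).withTransportedTorus g g' hgg' hg'g hgΩ)), IsCompact C →
        IsCompact (closure (((torusFinSplit ((PlaneData.mixedRow q a b).withTransportedTorus g g' hgg' hg'g hgΩ)
          (placesAbove (k := k) p)) ⁻¹' (Set.univ ×ˢ DA)) ∩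
          (C * (ZfIn ((PlaneData.mixedRow q a b).withTransportedTorus g g' hgg' hg'g hgΩ) : Set _)))) :=
  exists_isFundamentalDomain_prod_univ_withTransportedTorus q a b g g' hgg' hg'g hgΩ ha hb ht hn hreal hcm hp hns νf νS
    νA c hc hZc (compactSpace_torusFinAt_withTransportedTorus_of_nonsplit q a b g g' hgg' hg'g hgΩ ha hb ht hn p
      hp.ne_zero hns)

end Row

end Summit.Ventures.HodgeRepro.Tier4.Line4

end
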